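import Literature.Geometry.Riemannian.SphericalCylinderEntropy

/-!
# The lever of line `ball-mass-slack`, candidate-proved (refuter drefute gen 2; NOT a landing)
(crux `CylinderEntropy.ThinCrossSectionExists`, stmt-SmoothPoincare4-7633)

This file concatenates the three verbatim stub proofs `kernelDomination` (C-dom), `levelComparison` (C-level),
`layerCakeCore` (C-core) and glues them into the ledger-ACTIVE registered 4-stub statement `stub_layerCake` (C) of the
planner skeleton df42569b, in LITERAL form (the skeleton's aliases `HarnackRadial`, `ZonalMonotone`, `cylN`,
`SubsphericalMassIntr`, `InN`, `slice₀`, `e₀` unfolded, since `Lines/ball-mass-slack.lean` is not an importable module):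
`layerCake : A → B → ∀ Λ S ⊆ N, (Λ-subspherical intrinsic ball mass of S) → ∀ p ∈ N, τ > 0, F̂_{p,τ}(S) ≤ Λ·F̂_{e₀,τ}(slice₀)`.
So, given the two cited heat-kernel facts A (⇐ H, Hamilton 1993; A′ proved by gen 1) and B (Cheeger–Yau), the relative
lever holds for EVERY `S ⊆ N` — no measurability, no compactness, every `Λ : ℝ≥0∞`.
-/


open Literature.Geometry.Riemannian.SphericalCylinderEntropy (zonal cylKernel cylKernel_eq abs_sum_mul_le_one)
open Real Set

namespace Refuter.DrefuteG2_7633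

/-- The radial majorant profile. -/
noncomputable def prof (τ r : ℝ) : ℝ :=
  max 0 (zonal τ (Real.cos (min (max r 0) Real.pi)) *
    Real.exp (((min (max r 0) Real.pi) ^ 2 - (max r 0) ^ 2) / (4 * τ)))

theorem prof_nonneg (τ r : ℝ) : 0 ≤ prof τ r := le_max_left _ _

/-- The exponent `(min ρ π)² - ρ²` is antitone in `ρ ≥ 0`. -/
theorem expo_antitone {ρ₁ ρ₂ : ℝ} (h0 : 0 ≤ ρ₁) (h : ρ₁ ≤ ρ₂) :
    (min ρ₂ Real.pi) ^ 2 - ρ₂ ^ 2 ≤ (min ρ₁ Real.pi) ^ 2 - ρ₁ ^ 2 := by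
  have hπ := Real.pi_pos
  rcases le_total ρ₂ Real.pi with h2 | h2
  · rw [min_eq_left h2, min_eq_left (h.trans h2)]; simp
  · rw [min_eq_right h2]
    rcases le_total ρ₁ Real.pi with h1 | h1
    · rw [min_eq_left h1]
      nlinarith
    · rw [min_eq_right h1]
      nlinarith

theorem prof_antitone {τ : ℝ} (hτ : 0 < τ) (hB : MonotoneOn (zonal τ) (Set.Icc (-1) 1)) :
    Antitone (prof τ) := by
  intro r₁ r₂ h
  unfold prof
  set ρ₁ := max r₁ 0 with hρ₁
  set ρ₂ := max r₂ 0 with hρ₂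
  have hρ0 : 0 ≤ ρ₁ := le_max_right _ _
  have hρ : ρ₁ ≤ ρ₂ := max_le_max h le_rfl
  set θ₁ := min ρ₁ Real.pi with hθ₁
  set θ₂ := min ρ₂ Real.pi with hθ₂
  have hθ0 : 0 ≤ θ₁ := le_min hρ0 Real.pi_pos.le
  have hθ12 : θ₁ ≤ θ₂ := min_le_min hρ le_rfl
  have hθπ : θ₂ ≤ Real.pi := min_le_right _ _
  have hcos : Real.cos θ₂ ≤ Real.cos θ₁ := Real.cos_le_cos_of_nonneg_of_le_pi hθ0 hθπ hθ12
  have hz : zonal τ (Real.cos θ₂) ≤ zonal τ (Real.cos θ₁) :=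
    hB ⟨Real.neg_one_le_cos _, Real.cos_le_one _⟩ ⟨Real.neg_one_le_cos _, Real.cos_le_one _⟩ hcos
  have hexpo := expo_antitone hρ0 hρ
  have h4 : (0 : ℝ) < 4 * τ := by linarith
  have he : Real.exp ((θ₂ ^ 2 - ρ₂ ^ 2) / (4 * τ)) ≤ Real.exp ((θ₁ ^ 2 - ρ₁ ^ 2) / (4 * τ)) :=
    Real.exp_le_exp.2 (div_le_div_of_nonneg_right hexpo h4.le)
  have he1 : 0 < Real.exp ((θ₁ ^ 2 - ρ₁ ^ 2) / (4 * τ)) := Real.exp_pos _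
  have he2 : 0 < Real.exp ((θ₂ ^ 2 - ρ₂ ^ 2) / (4 * τ)) := Real.exp_pos _
  refine max_le (le_max_left _ _) ?_
  rcases le_or_gt (zonal τ (Real.cos θ₂)) 0 with hz2 | hz2
  · exact le_trans (mul_nonpos_of_nonpos_of_nonneg hz2 he2.le) (le_max_left _ _)
  · refine le_trans ?_ (le_max_right _ _)
    calc zonal τ (Real.cos θ₂) * Real.exp ((θ₂ ^ 2 - ρ₂ ^ 2) / (4 * τ))
        ≤ zonal τ (Real.cos θ₂) * Real.exp ((θ₁ ^ 2 - ρ₁ ^ 2) / (4 * τ)) :=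
          mul_le_mul_of_nonneg_left he hz2.le
      _ ≤ zonal τ (Real.cos θ₁) * Real.exp ((θ₁ ^ 2 - ρ₁ ^ 2) / (4 * τ)) :=
          mul_le_mul_of_nonneg_right hz he1.le

/-- Core domination: for `|x| ≤ 1`, `𝔥(τ,x)·e^{-h²/4τ} ≤ F(√(arccos x² + h²))`, from A. -/
theorem dom_core {τ : ℝ}
    (hA : MonotoneOn (fun θ : ℝ => zonal τ (Real.cos θ) * Real.exp (θ ^ 2 / (4 * τ))) (Set.Icc 0 Real.pi))
    {x : ℝ} (hx : |x| ≤ 1) (h : ℝ) :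
    zonal τ x * Real.exp (-(h ^ 2) / (4 * τ)) ≤ prof τ (Real.sqrt (Real.arccos x ^ 2 + h ^ 2)) := by
  obtain ⟨hx1, hx2⟩ := abs_le.1 hx
  set θ := Real.arccos x with hθ
  have hθ0 : 0 ≤ θ := Real.arccos_nonneg x
  have hθπ : θ ≤ Real.pi := Real.arccos_le_pi x
  have hcosθ : Real.cos θ = x := Real.cos_arccos hx1 hx2
  set r := Real.sqrt (θ ^ 2 + h ^ 2) with hr
  have hr0 : 0 ≤ r := Real.sqrt_nonneg _
  have hsq : r ^ 2 = θ ^ 2 + h ^ 2 := Real.sq_sqrt (by positivity)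
  have hθr : θ ≤ r := by
    rw [hr]
    calc θ = Real.sqrt (θ ^ 2) := (Real.sqrt_sq hθ0).symm
      _ ≤ Real.sqrt (θ ^ 2 + h ^ 2) := Real.sqrt_le_sqrt (by nlinarith [sq_nonneg h])
  unfold prof
  rw [max_eq_left hr0]
  set θs := min r Real.pi with hθs
  have hθs0 : 0 ≤ θs := le_min hr0 Real.pi_pos.le
  have hθsπ : θs ≤ Real.pi := min_le_right _ _
  have hθθs : θ ≤ θs := le_min hθr hθπ
  have hmono : zonal τ (Real.cos θ) * Real.exp (θ ^ 2 / (4 * τ)) ≤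
      zonal τ (Real.cos θs) * Real.exp (θs ^ 2 / (4 * τ)) :=
    hA ⟨hθ0, hθπ⟩ ⟨hθs0, hθsπ⟩ hθθs
  set c := Real.exp (-(θ ^ 2 + h ^ 2) / (4 * τ)) with hc
  have hc0 : 0 ≤ c := (Real.exp_pos _).le
  have e1 : zonal τ x * Real.exp (-(h ^ 2) / (4 * τ)) =
      (zonal τ (Real.cos θ) * Real.exp (θ ^ 2 / (4 * τ))) * c := by
    rw [hcosθ, mul_assoc, hc, ← Real.exp_add]
    congr 2
    ring
  have e2 : zonal τ (Real.cos θs) * Real.exp ((θs ^ 2 - r ^ 2) / (4 * τ)) =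
      (zonal τ (Real.cos θs) * Real.exp (θs ^ 2 / (4 * τ))) * c := by
    rw [mul_assoc, hc, ← Real.exp_add, hsq]
    congr 2
    ring
  refine le_trans ?_ (le_max_right _ _)
  rw [e1, e2]
  exact mul_le_mul_of_nonneg_right hmono hc0

/-- `∑_{i<5} y_i (e₀)_i = y₀` for `e₀ = single 0 1`. -/
theorem sum_mul_single (y : EuclideanSpace ℝ (Fin 6)) :
    ∑ i : Fin 5, y (Fin.castSucc i) * (EuclideanSpace.single (0 : Fin 6) (1 : ℝ) : EuclideanSpace ℝ (Fin 6)) (Fin.castSucc i) = y 0 := by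
  rw [Finset.sum_eq_single (0 : Fin 5)]
  · simp
  · intro i _ hi
    have : (Fin.castSucc i : Fin 6) ≠ 0 := fun h => hi (Fin.castSucc_eq_zero_iff.1 h)
    simp [this]
  · simp

theorem single_five : (EuclideanSpace.single (0 : Fin 6) (1 : ℝ) : EuclideanSpace ℝ (Fin 6)) 5 = 0 := by simp

/-- `|y₀| ≤ 1` on `N`. -/
theorem abs_apply_zero_le_one {y : EuclideanSpace ℝ (Fin 6)} (hy : ∑ i : Fin 5, y (Fin.castSucc i) ^ 2 = 1) :
    |y 0| ≤ 1 := by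
  rw [← sq_le_one_iff_abs_le_one]
  have h := Finset.single_le_sum (f := fun i : Fin 5 => y (Fin.castSucc i) ^ 2) (fun i _ => sq_nonneg _)
    (Finset.mem_univ (0 : Fin 5))
  simpa [hy] using h

theorem ofReal_max_zero_le (a : ℝ) : ENNReal.ofReal (max 0 a) ≤ ENNReal.ofReal a := by
  rcases le_total 0 a with h | h
  · rw [max_eq_right h]
  · rw [max_eq_left h, ENNReal.ofReal_zero]; exact bot_le

/-- **Stub C-dom, verbatim.** -/
theorem kernelDomination :
    (∀ τ : ℝ, 0 < τ →
        MonotoneOn (fun θ : ℝ => zonal τ (Real.cos θ) * Real.exp (θ ^ 2 / (4 * τ))) (Set.Icc 0 Real.pi)) →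
    (∀ τ : ℝ, 0 < τ → MonotoneOn (zonal τ) (Set.Icc (-1) 1)) →
      ∀ τ : ℝ, 0 < τ → ∃ F : ℝ → ℝ, Antitone F ∧ (∀ r : ℝ, 0 ≤ F r) ∧
        (∀ p y : EuclideanSpace ℝ (Fin 6), ∑ i : Fin 5, p (Fin.castSucc i) ^ 2 = 1 → ∑ i : Fin 5, y (Fin.castSucc i) ^ 2 = 1 →
            cylKernel p τ y ≤ F (Real.sqrt (Real.arccos (∑ i : Fin 5, y (Fin.castSucc i) * p (Fin.castSucc i)) ^ 2 + (y 5 - p 5) ^ 2))) ∧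
        (∀ y : EuclideanSpace ℝ (Fin 6), ∑ i : Fin 5, y (Fin.castSucc i) ^ 2 = 1 → y 5 = 0 →
            ENNReal.ofReal (F (Real.sqrt (Real.arccos (∑ i : Fin 5, y (Fin.castSucc i) * (EuclideanSpace.single 0 1 : EuclideanSpace ℝ (Fin 6)) (Fin.castSucc i)) ^ 2 + (y 5 - (EuclideanSpace.single 0 1 : EuclideanSpace ℝ (Fin 6)) 5) ^ 2))) ≤
              ENNReal.ofReal (cylKernel (EuclideanSpace.single 0 1 : EuclideanSpace ℝ (Fin 6)) τ y)) := by
  intro hA hB τ hτ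
  refine ⟨prof τ, prof_antitone hτ (hB τ hτ), prof_nonneg τ, ?_, ?_⟩
  · intro p y hp hy
    rw [cylKernel_eq]
    exact dom_core (hA τ hτ) (abs_sum_mul_le_one hy hp) (y 5 - p 5)
  · intro y hy hy5
    rw [sum_mul_single, single_five, hy5, cylKernel_eq, sum_mul_single, single_five, hy5]
    have hx := abs_apply_zero_le_one hy
    obtain ⟨hx1, hx2⟩ := abs_le.1 hx
    have ha0 : 0 ≤ Real.arccos (y 0) := Real.arccos_nonneg _
    have haπ : Real.arccos (y 0) ≤ Real.pi := Real.arccos_le_pi _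
    have hsqrt : Real.sqrt (Real.arccos (y 0) ^ 2 + (0 - 0) ^ 2) = Real.arccos (y 0) := by
      rw [sub_self, zero_pow two_ne_zero, add_zero, Real.sqrt_sq ha0]
    rw [hsqrt]
    unfold prof
    rw [max_eq_left ha0, min_eq_left haπ, Real.cos_arccos hx1 hx2, sub_self, zero_div, Real.exp_zero,
      mul_one, sub_self, zero_pow two_ne_zero, neg_zero, zero_div, Real.exp_zero, mul_one]
    exact ofReal_max_zero_le _

end Refuter.DrefuteG2_7633



open MeasureTheory Set
open scoped ENNReal BigOperators

namespace Refuter.DrefuteG2_7633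

local notation "E6" => EuclideanSpace ℝ (Fin 6)

/-- `y ∈ N`. -/
def InN (y : E6) : Prop := ∑ i : Fin 5, y (Fin.castSucc i) ^ 2 = 1

/-- squared product distance `arccos⟨y',p'⟩² + (y₅ - p₅)²`. -/
noncomputable def sq6 (y p : E6) : ℝ :=
  Real.arccos (∑ i : Fin 5, y (Fin.castSucc i) * p (Fin.castSucc i)) ^ 2 + (y 5 - p 5) ^ 2

/-- closed intrinsic ball (literal shape of the items). -/
def ball (p : E6) (r : ℝ) : Set E6 := {y | InN y ∧ sq6 y p ≤ r ^ 2}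

/-- the slice `S⁴ × {0}`. -/
def slice0 : Set E6 := {z | InN z ∧ z 5 = 0}

theorem sq6_nonneg (y p : E6) : 0 ≤ sq6 y p := by unfold sq6; positivity

theorem ball_mono (p : E6) {r r' : ℝ} (hr : 0 ≤ r) (h : r ≤ r') : ball p r ⊆ ball p r' := by
  rintro y ⟨hy, hyr⟩
  exact ⟨hy, hyr.trans (pow_le_pow_left₀ hr h 2)⟩

/-- On `N`, product distance `0` from `p ∈ N` forces `y = p`. -/
theorem eq_of_sq6_nonpos {y p : E6} (hy : InN y) (hp : InN p) (h : sq6 y p ≤ 0) : y = p := by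
  unfold sq6 at h
  unfold InN at hy hp
  have h1 : Real.arccos (∑ i : Fin 5, y (Fin.castSucc i) * p (Fin.castSucc i)) ^ 2 = 0 := by
    nlinarith [sq_nonneg (Real.arccos (∑ i : Fin 5, y (Fin.castSucc i) * p (Fin.castSucc i))),
      sq_nonneg (y 5 - p 5)]
  have h2 : (y 5 - p 5) ^ 2 = 0 := by
    nlinarith [sq_nonneg (Real.arccos (∑ i : Fin 5, y (Fin.castSucc i) * p (Fin.castSucc i))),
      sq_nonneg (y 5 - p 5)]
  have hx : 1 ≤ ∑ i : Fin 5, y (Fin.castSucc i) * p (Fin.castSucc i) :=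
    Real.arccos_eq_zero.1 ((pow_eq_zero_iff two_ne_zero).1 h1)
  have hexp : ∑ i : Fin 5, (y (Fin.castSucc i) - p (Fin.castSucc i)) ^ 2 =
      ∑ i : Fin 5, (y (Fin.castSucc i) ^ 2 - 2 * (y (Fin.castSucc i) * p (Fin.castSucc i)) +
        p (Fin.castSucc i) ^ 2) :=
    Finset.sum_congr rfl fun i _ => by ring
  rw [Finset.sum_add_distrib, Finset.sum_sub_distrib, ← Finset.mul_sum] at hexp
  have hsum : ∑ i : Fin 5, (y (Fin.castSucc i) - p (Fin.castSucc i)) ^ 2 = 0 := by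
    refine le_antisymm ?_ (Finset.sum_nonneg fun i _ => sq_nonneg _)
    rw [hexp, hy, hp]
    linarith
  have hcoord : ∀ i : Fin 5, y (Fin.castSucc i) = p (Fin.castSucc i) := by
    intro i
    have hi := (Finset.sum_eq_zero_iff_of_nonneg (fun j _ => sq_nonneg _)).1 hsum i (Finset.mem_univ i)
    exact sub_eq_zero.1 ((pow_eq_zero_iff two_ne_zero).1 hi)
  have h5 : y 5 = p 5 := sub_eq_zero.1 ((pow_eq_zero_iff two_ne_zero).1 h2)
  have h5' : y (Fin.last 5) = p (Fin.last 5) := h5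
  ext i
  exact Fin.lastCases h5' (fun j => hcoord j) i

variable (μ : Measure E6) [NullSingletonClass μ]

/-- **Core of stub C-level**, for any measure with null singletons. -/
theorem levelComparison_core (Λ : ℝ≥0∞) (S : Set E6) (F : ℝ → ℝ) (p e : E6) (t : ℝ)
    (hS : ∀ y ∈ S, InN y) (he : ∀ y ∈ slice0, InN y)
    (hm : ∀ r : ℝ, 0 < r → μ (S ∩ ball p r) ≤ Λ * μ (slice0 ∩ ball e r))
    (hF : Antitone F) (hp : InN p) :
    μ (S ∩ {y | t < F (Real.sqrt (sq6 y p))}) ≤ Λ * μ (slice0 ∩ {y | t < F (Real.sqrt (sq6 y e))}) := by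
  by_cases h0 : t < F 0
  swap
  · -- `F 0 ≤ t`: the level set is empty
    have hempty : S ∩ {y | t < F (Real.sqrt (sq6 y p))} = ∅ := by
      ext y
      simp only [mem_inter_iff, mem_setOf_eq, mem_empty_iff_false, iff_false, not_and, not_lt]
      intro _
      exact (hF (Real.sqrt_nonneg _)).trans (not_lt.1 h0)
    rw [hempty, measure_empty]
    exact bot_le
  by_cases hall : ∀ r : ℝ, 0 ≤ r → t < F r
  · -- `J = [0, ∞)`: LHS ≤ μ S = sup over balls of radius n+1; RHS = Λ μ slice0
    have hR : slice0 ∩ {y | t < F (Real.sqrt (sq6 y e))} = slice0 := by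
      ext y
      simp only [mem_inter_iff, mem_setOf_eq, and_iff_left_iff_imp]
      intro _
      exact hall _ (Real.sqrt_nonneg _)
    have hU : S = ⋃ n : ℕ, S ∩ ball p ((n : ℝ) + 1) := by
      ext y
      simp only [mem_iUnion, mem_inter_iff]
      constructor
      · intro hy
        refine ⟨⌈sq6 y p⌉₊, hy, hS y hy, ?_⟩
        have h1 : sq6 y p ≤ (⌈sq6 y p⌉₊ : ℝ) := Nat.le_ceil _
        have h2 : (0 : ℝ) ≤ (⌈sq6 y p⌉₊ : ℝ) := Nat.cast_nonneg _
        nlinarith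
      · rintro ⟨n, hy, -⟩
        exact hy
    have hmono : Monotone fun n : ℕ => S ∩ ball p ((n : ℝ) + 1) := by
      intro m n hmn
      exact inter_subset_inter_right _ (ball_mono p (by positivity) (by exact_mod_cast Nat.succ_le_succ hmn))
    rw [hR]
    calc μ (S ∩ {y | t < F (Real.sqrt (sq6 y p))}) ≤ μ S := measure_mono inter_subset_left
      _ = μ (⋃ n : ℕ, S ∩ ball p ((n : ℝ) + 1)) := by rw [← hU]
      _ = ⨆ n : ℕ, μ (S ∩ ball p ((n : ℝ) + 1)) := hmono.measure_iUnion
      _ ≤ ⨆ n : ℕ, Λ * μ (slice0 ∩ ball e ((n : ℝ) + 1)) := iSup_mono fun n => hm _ (by positivity)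
      _ ≤ Λ * μ slice0 := iSup_le fun n => mul_le_mul' le_rfl (measure_mono inter_subset_left)
  · -- `J` bounded: `R = sup J`
    push Not at hall
    obtain ⟨r₀, hr₀0, hr₀⟩ := hall
    set J : Set ℝ := {r | 0 ≤ r ∧ t < F r} with hJ
    have hJne : J.Nonempty := ⟨0, le_rfl, h0⟩
    have hJbdd : BddAbove J := by
      refine ⟨r₀, fun r hr => ?_⟩
      by_contra hlt
      push Not at hlt
      exact absurd (lt_of_lt_of_le hr.2 (hF hlt.le)) (not_lt.2 hr₀)
    set R := sSup J with hRdef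
    have hR0 : 0 ≤ R := le_csSup hJbdd ⟨le_rfl, h0⟩
    have hbelow : ∀ r, 0 ≤ r → r < R → t < F r := fun r hr hrR => by
      obtain ⟨b, hb, hrb⟩ := (lt_csSup_iff hJbdd hJne).1 hrR
      exact lt_of_lt_of_le hb.2 (hF hrb.le)
    have habove : ∀ r, R < r → F r ≤ t := fun r hRr => by
      by_contra hlt
      push Not at hlt
      have : r ≤ R := le_csSup hJbdd ⟨hR0.trans hRr.le, hlt⟩
      linarith
    by_cases hRJ : t < F R
    · -- `J = [0, R]`: the level sets are the closed balls of radius `R`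
      have key : ∀ q y : E6, t < F (Real.sqrt (sq6 y q)) ↔ sq6 y q ≤ R ^ 2 := by
        intro q y
        constructor
        · intro h
          by_contra hgt
          push Not at hgt
          have : R < Real.sqrt (sq6 y q) := (Real.lt_sqrt hR0).2 hgt
          exact absurd h (not_lt.2 (habove _ this))
        · intro h
          have h1 : Real.sqrt (sq6 y q) ≤ R := (Real.sqrt_le_left hR0).2 h
          rcases h1.lt_or_eq with hlt | heq
          · exact hbelow _ (Real.sqrt_nonneg _) hlt
          · rw [heq]; exact hRJ
      rcases hR0.lt_or_eq with hRpos | hR0'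
      · have e1 : S ∩ {y | t < F (Real.sqrt (sq6 y p))} = S ∩ ball p R := by
          ext y
          simp only [mem_inter_iff, mem_setOf_eq, ball]
          constructor
          · rintro ⟨hy, h⟩; exact ⟨hy, hS y hy, (key p y).1 h⟩
          · rintro ⟨hy, -, h⟩; exact ⟨hy, (key p y).2 h⟩
        have e2 : slice0 ∩ {y | t < F (Real.sqrt (sq6 y e))} = slice0 ∩ ball e R := by
          ext y
          simp only [mem_inter_iff, mem_setOf_eq, ball]
          constructor
          · rintro ⟨hy, h⟩; exact ⟨hy, he y hy, (key e y).1 h⟩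
          · rintro ⟨hy, -, h⟩; exact ⟨hy, (key e y).2 h⟩
        rw [e1, e2]
        exact hm R hRpos
      · -- `R = 0`: the level set is `⊆ {p}`
        have hsub : S ∩ {y | t < F (Real.sqrt (sq6 y p))} ⊆ {p} := by
          rintro y ⟨hy, h⟩
          have h' := (key p y).1 h
          rw [← hR0'] at h'
          have h'' : sq6 y p ≤ 0 := by simpa using h'
          exact eq_of_sq6_nonpos (hS y hy) hp h''
        calc μ (S ∩ {y | t < F (Real.sqrt (sq6 y p))}) ≤ μ {p} := measure_mono hsub
          _ = 0 := measure_singleton p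
          _ ≤ _ := bot_le
    · -- `J = [0, R)` with `R > 0`: continuity from below along radii `R - R/(n+2)`
      have hRpos : 0 < R := by
        rcases hR0.lt_or_eq with h | h
        · exact h
        · exact absurd (h ▸ h0) hRJ
      have key : ∀ q y : E6, t < F (Real.sqrt (sq6 y q)) ↔ sq6 y q < R ^ 2 := by
        intro q y
        constructor
        · intro h
          by_contra hge
          push Not at hge
          have h1 : R ≤ Real.sqrt (sq6 y q) := Real.le_sqrt_of_sq_le hge
          rcases h1.lt_or_eq with hlt | heq
          · exact absurd h (not_lt.2 (habove _ hlt))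
          · rw [← heq] at h; exact absurd h hRJ
        · intro h
          exact hbelow _ (Real.sqrt_nonneg _) ((Real.sqrt_lt' hRpos).2 h)
      set rad : ℕ → ℝ := fun n => R - R / ((n : ℝ) + 2) with hrad
      have hrad_pos : ∀ n : ℕ, 0 < rad n := by
        intro n
        simp only [hrad]
        have hn : (0 : ℝ) < (n : ℝ) + 2 := by positivity
        rw [sub_pos, div_lt_iff₀ hn]
        nlinarith
      have hrad_lt : ∀ n : ℕ, rad n < R := by
        intro n
        simp only [hrad]
        have : 0 < R / ((n : ℝ) + 2) := by positivity
        linarith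
      have hrad_mono : Monotone rad := by
        intro m n hmn
        simp only [hrad]
        have hm2 : (0 : ℝ) < (m : ℝ) + 2 := by positivity
        have hmn' : (m : ℝ) + 2 ≤ (n : ℝ) + 2 := by exact_mod_cast Nat.add_le_add_right hmn 2
        have := div_le_div_of_nonneg_left hR0 hm2 hmn'
        linarith
      have hsq_lt : ∀ n : ℕ, rad n ^ 2 < R ^ 2 := fun n =>
        pow_lt_pow_left₀ (hrad_lt n) (hrad_pos n).le two_ne_zero
      have e1 : S ∩ {y | t < F (Real.sqrt (sq6 y p))} = ⋃ n : ℕ, S ∩ ball p (rad n) := by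
        ext y
        simp only [mem_iUnion, mem_inter_iff, mem_setOf_eq, ball]
        constructor
        · rintro ⟨hy, h⟩
          have hlt : sq6 y p < R ^ 2 := (key p y).1 h
          set s := Real.sqrt (sq6 y p) with hs
          have hs0 : 0 ≤ s := Real.sqrt_nonneg _
          have hsR : s < R := (Real.sqrt_lt' hRpos).2 hlt
          have hRs : 0 < R - s := sub_pos.2 hsR
          obtain ⟨n, hn⟩ := exists_nat_ge (R / (R - s))
          refine ⟨n, hy, hS y hy, ?_⟩
          have hn1 : R ≤ (n : ℝ) * (R - s) := (div_le_iff₀ hRs).1 hn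
          have hsle : s ≤ rad n := by
            simp only [hrad]
            have hn2 : (0 : ℝ) < (n : ℝ) + 2 := by positivity
            rw [le_sub_iff_add_le, ← le_sub_iff_add_le', div_le_iff₀ hn2]
            nlinarith
          exact (Real.sqrt_le_left (hrad_pos n).le).1 hsle
        · rintro ⟨n, hy, -, h⟩
          exact ⟨hy, (key p y).2 (lt_of_le_of_lt h (hsq_lt n))⟩
      have hmono : Monotone fun n : ℕ => S ∩ ball p (rad n) := fun m n hmn =>
        inter_subset_inter_right _ (ball_mono p (hrad_pos m).le (hrad_mono hmn))
      rw [e1, hmono.measure_iUnion]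
      refine iSup_le fun n => (hm _ (hrad_pos n)).trans ?_
      refine mul_le_mul' le_rfl (measure_mono ?_)
      rintro y ⟨hy, -, h⟩
      exact ⟨hy, (key e y).2 (lt_of_le_of_lt h (hsq_lt n))⟩

/-- **Stub C-level, verbatim.** -/
theorem levelComparison :
    ∀ (Λ : ℝ≥0∞) (S : Set (EuclideanSpace ℝ (Fin 6))) (F : ℝ → ℝ) (p : EuclideanSpace ℝ (Fin 6)) (t : ℝ),
      (∀ y ∈ S, ∑ i : Fin 5, y (Fin.castSucc i) ^ 2 = 1) →
      (∀ p : EuclideanSpace ℝ (Fin 6), ∑ i : Fin 5, p (Fin.castSucc i) ^ 2 = 1 → ∀ r : ℝ, 0 < r →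
          μH[4] (S ∩ {y : EuclideanSpace ℝ (Fin 6) | ∑ i : Fin 5, y (Fin.castSucc i) ^ 2 = 1 ∧ Real.arccos (∑ i : Fin 5, y (Fin.castSucc i) * p (Fin.castSucc i)) ^ 2 + (y 5 - p 5) ^ 2 ≤ r ^ 2}) ≤
            Λ * μH[4] ({z : EuclideanSpace ℝ (Fin 6) | ∑ i : Fin 5, z (Fin.castSucc i) ^ 2 = 1 ∧ z 5 = 0} ∩
              {y : EuclideanSpace ℝ (Fin 6) | ∑ i : Fin 5, y (Fin.castSucc i) ^ 2 = 1 ∧ Real.arccos (∑ i : Fin 5, y (Fin.castSucc i) * (EuclideanSpace.single 0 1 : EuclideanSpace ℝ (Fin 6)) (Fin.castSucc i)) ^ 2 + (y 5 - (EuclideanSpace.single 0 1 : EuclideanSpace ℝ (Fin 6)) 5) ^ 2 ≤ r ^ 2})) →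
      Antitone F → ∑ i : Fin 5, p (Fin.castSucc i) ^ 2 = 1 →
        μH[4] (S ∩ {y : EuclideanSpace ℝ (Fin 6) | t < F (Real.sqrt (Real.arccos (∑ i : Fin 5, y (Fin.castSucc i) * p (Fin.castSucc i)) ^ 2 + (y 5 - p 5) ^ 2))}) ≤
            Λ * μH[4] ({z : EuclideanSpace ℝ (Fin 6) | ∑ i : Fin 5, z (Fin.castSucc i) ^ 2 = 1 ∧ z 5 = 0} ∩ {y : EuclideanSpace ℝ (Fin 6) | t < F (Real.sqrt (Real.arccos (∑ i : Fin 5, y (Fin.castSucc i) * (EuclideanSpace.single 0 1 : EuclideanSpace ℝ (Fin 6)) (Fin.castSucc i)) ^ 2 + (y 5 - (EuclideanSpace.single 0 1 : EuclideanSpace ℝ (Fin 6)) 5) ^ 2))}) := by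
  intro Λ S F p t hS hm hF hp
  haveI : NullSingletonClass (μH[4] : Measure (EuclideanSpace ℝ (Fin 6))) :=
    Measure.nullSingletonClass_hausdorff _ (by norm_num)
  exact levelComparison_core μH[4] Λ S F p (EuclideanSpace.single 0 1) t hS (fun y hy => hy.1)
    (fun r hr => hm p hp r hr) hF hp

end Refuter.DrefuteG2_7633



open MeasureTheory Set Filter
open scoped ENNReal BigOperators
open Literature.Geometry.Riemannian.SphericalCylinderEntropy (cylKernel cylDensity)

namespace Refuter.DrefuteG2_7633.Core

local notation "E6" => EuclideanSpace ℝ (Fin 6)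


theorem continuous_coord (i : Fin 6) : Continuous fun z : E6 => z i := by fun_prop

theorem continuous_sumSq : Continuous fun z : E6 => ∑ i : Fin 5, z (Fin.castSucc i) ^ 2 :=
  continuous_finsetSum _ fun _ _ => (continuous_coord _).pow 2

theorem continuous_sq6 (q : E6) : Continuous fun z : E6 => sq6 z q := by
  unfold sq6
  refine ((Real.continuous_arccos.comp ?_).pow 2).add (((continuous_coord 5).sub continuous_const).pow 2)
  exact continuous_finsetSum _ fun _ _ => (continuous_coord _).mul continuous_const

theorem measurableSet_N : MeasurableSet {z : E6 | InN z} :=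
  (isClosed_eq continuous_sumSq continuous_const).measurableSet

theorem measurableSet_slice0 : MeasurableSet slice0 := by
  have h : slice0 = {z : E6 | InN z} ∩ {z : E6 | z 5 = 0} := by
    ext z; simp [slice0]
  rw [h]
  exact measurableSet_N.inter (isClosed_eq (continuous_coord 5) continuous_const).measurableSet

theorem measurable_level {F : ℝ → ℝ} (hF : Antitone F) (q : E6) :
    Measurable fun y : E6 => F (Real.sqrt (sq6 y q)) :=
  hF.measurable.comp (Real.continuous_sqrt.comp (continuous_sq6 q)).measurable

/-- **Core of stub C-core** (the two layer cakes), for the literal functional `cylDensity`. -/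
theorem layerCake_core (τ : ℝ) (Λ : ℝ≥0∞) (S : Set E6) (F : ℝ → ℝ) (p e : E6)
    (hS : ∀ y ∈ S, InN y) (hF : Antitone F) (hF0 : ∀ r : ℝ, 0 ≤ F r)
    (hdom : ∀ y : E6, InN y → cylKernel p τ y ≤ F (Real.sqrt (sq6 y p)))
    (hex : ∀ y : E6, InN y → y 5 = 0 →
      ENNReal.ofReal (F (Real.sqrt (sq6 y e))) ≤ ENNReal.ofReal (cylKernel e τ y))
    (hlev : ∀ t : ℝ, 0 < t →
      μH[4] (S ∩ {y | t < F (Real.sqrt (sq6 y p))}) ≤ Λ * μH[4] (slice0 ∩ {y | t < F (Real.sqrt (sq6 y e))})) :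
    cylDensity S p τ ≤ Λ * cylDensity slice0 e τ := by
  have hfp := measurable_level hF p
  have hfe := measurable_level hF e
  -- Step 1: domination, a.e. on `μH⁴|S`
  have h1 : ∫⁻ z in S, ENNReal.ofReal (cylKernel p τ z) ∂μH[4] ≤
      ∫⁻ z in S, ENNReal.ofReal (F (Real.sqrt (sq6 z p))) ∂μH[4] := by
    refine lintegral_mono_ae ?_
    have hae : ∀ᵐ z ∂((μH[4] : Measure E6).restrict S), InN z := by
      rw [ae_iff, ← compl_setOf, Measure.restrict_apply measurableSet_N.compl]
      have hempty : {z : E6 | InN z}ᶜ ∩ S = ∅ := by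
        ext z
        simp only [mem_inter_iff, mem_compl_iff, mem_setOf_eq, mem_empty_iff_false, iff_false, not_and]
        intro hz hzS
        exact hz (hS z hzS)
      rw [hempty, measure_empty]
    filter_upwards [hae] with z hz
    exact ENNReal.ofReal_le_ofReal (hdom z hz)
  -- Step 2: layer cake on `μH⁴|S`
  have h2 : ∫⁻ z in S, ENNReal.ofReal (F (Real.sqrt (sq6 z p))) ∂μH[4] =
      ∫⁻ t in Ioi 0, μH[4] (S ∩ {y | t < F (Real.sqrt (sq6 y p))}) := by
    rw [lintegral_eq_lintegral_meas_lt _ (Eventually.of_forall fun z => hF0 _) hfp.aemeasurable]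
    refine lintegral_congr fun t => ?_
    rw [Measure.restrict_apply (measurableSet_lt measurable_const hfp), inter_comm]
  -- Step 3: the per-level hypothesis
  have h3 : ∫⁻ t in Ioi 0, μH[4] (S ∩ {y | t < F (Real.sqrt (sq6 y p))}) ≤
      ∫⁻ t in Ioi 0, Λ * μH[4] (slice0 ∩ {y | t < F (Real.sqrt (sq6 y e))}) :=
    setLIntegral_mono' measurableSet_Ioi fun t ht => hlev t ht
  -- Step 4: pull `Λ` out (the level-measure function is antitone in `t`, hence measurable)
  have hanti : Antitone fun t : ℝ => μH[4] (slice0 ∩ {y : E6 | t < F (Real.sqrt (sq6 y e))}) := by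
    intro t t' htt'
    exact measure_mono fun y hy => ⟨hy.1, lt_of_le_of_lt htt' hy.2⟩
  have h4 : ∫⁻ t in Ioi 0, Λ * μH[4] (slice0 ∩ {y | t < F (Real.sqrt (sq6 y e))}) =
      Λ * ∫⁻ t in Ioi 0, μH[4] (slice0 ∩ {y | t < F (Real.sqrt (sq6 y e))}) :=
    lintegral_const_mul Λ hanti.measurable
  -- Step 5: layer cake backwards on the slice
  have h5 : ∫⁻ t in Ioi 0, μH[4] (slice0 ∩ {y | t < F (Real.sqrt (sq6 y e))}) =
      ∫⁻ z in slice0, ENNReal.ofReal (F (Real.sqrt (sq6 z e))) ∂μH[4] := by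
    rw [lintegral_eq_lintegral_meas_lt _ (Eventually.of_forall fun z => hF0 _) hfe.aemeasurable]
    refine lintegral_congr fun t => ?_
    rw [Measure.restrict_apply (measurableSet_lt measurable_const hfe), inter_comm]
  -- Step 6: exactness on the slice
  have h6 : ∫⁻ z in slice0, ENNReal.ofReal (F (Real.sqrt (sq6 z e))) ∂μH[4] ≤
      ∫⁻ z in slice0, ENNReal.ofReal (cylKernel e τ z) ∂μH[4] :=
    setLIntegral_mono' measurableSet_slice0 fun z hz => hex z hz.1 hz.2
  -- assemble
  have hchain : ∫⁻ z in S, ENNReal.ofReal (cylKernel p τ z) ∂μH[4] ≤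
      Λ * ∫⁻ z in slice0, ENNReal.ofReal (cylKernel e τ z) ∂μH[4] :=
    calc ∫⁻ z in S, ENNReal.ofReal (cylKernel p τ z) ∂μH[4]
        ≤ ∫⁻ z in S, ENNReal.ofReal (F (Real.sqrt (sq6 z p))) ∂μH[4] := h1
      _ = ∫⁻ t in Ioi 0, μH[4] (S ∩ {y | t < F (Real.sqrt (sq6 y p))}) := h2
      _ ≤ ∫⁻ t in Ioi 0, Λ * μH[4] (slice0 ∩ {y | t < F (Real.sqrt (sq6 y e))}) := h3
      _ = Λ * ∫⁻ t in Ioi 0, μH[4] (slice0 ∩ {y | t < F (Real.sqrt (sq6 y e))}) := h4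
      _ = Λ * ∫⁻ z in slice0, ENNReal.ofReal (F (Real.sqrt (sq6 z e))) ∂μH[4] := by rw [h5]
      _ ≤ Λ * ∫⁻ z in slice0, ENNReal.ofReal (cylKernel e τ z) ∂μH[4] := mul_le_mul' le_rfl h6
  unfold cylDensity
  calc (μH[4] (Metric.sphere (0 : EuclideanSpace ℝ (Fin 5)) 1))⁻¹ *
        ∫⁻ z in S, ENNReal.ofReal (cylKernel p τ z) ∂μH[4]
      ≤ (μH[4] (Metric.sphere (0 : EuclideanSpace ℝ (Fin 5)) 1))⁻¹ *
          (Λ * ∫⁻ z in slice0, ENNReal.ofReal (cylKernel e τ z) ∂μH[4]) := mul_le_mul' le_rfl hchain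
    _ = Λ * ((μH[4] (Metric.sphere (0 : EuclideanSpace ℝ (Fin 5)) 1))⁻¹ *
          ∫⁻ z in slice0, ENNReal.ofReal (cylKernel e τ z) ∂μH[4]) := by
        rw [mul_left_comm]

/-- **Stub C-core, verbatim.** -/
theorem layerCakeCore :
    ∀ (τ : ℝ) (Λ : ℝ≥0∞) (S : Set (EuclideanSpace ℝ (Fin 6))) (F : ℝ → ℝ) (p : EuclideanSpace ℝ (Fin 6)),
      (∀ y ∈ S, ∑ i : Fin 5, y (Fin.castSucc i) ^ 2 = 1) →
      Antitone F → (∀ r : ℝ, 0 ≤ F r) → ∑ i : Fin 5, p (Fin.castSucc i) ^ 2 = 1 →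
      (∀ y : EuclideanSpace ℝ (Fin 6), ∑ i : Fin 5, y (Fin.castSucc i) ^ 2 = 1 → cylKernel p τ y ≤ F (Real.sqrt (Real.arccos (∑ i : Fin 5, y (Fin.castSucc i) * p (Fin.castSucc i)) ^ 2 + (y 5 - p 5) ^ 2))) →
      (∀ y : EuclideanSpace ℝ (Fin 6), ∑ i : Fin 5, y (Fin.castSucc i) ^ 2 = 1 → y 5 = 0 →
            ENNReal.ofReal (F (Real.sqrt (Real.arccos (∑ i : Fin 5, y (Fin.castSucc i) * (EuclideanSpace.single 0 1 : EuclideanSpace ℝ (Fin 6)) (Fin.castSucc i)) ^ 2 + (y 5 - (EuclideanSpace.single 0 1 : EuclideanSpace ℝ (Fin 6)) 5) ^ 2))) ≤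
              ENNReal.ofReal (cylKernel (EuclideanSpace.single 0 1 : EuclideanSpace ℝ (Fin 6)) τ y)) →
      (∀ t : ℝ, 0 < t →
          μH[4] (S ∩ {y : EuclideanSpace ℝ (Fin 6) | t < F (Real.sqrt (Real.arccos (∑ i : Fin 5, y (Fin.castSucc i) * p (Fin.castSucc i)) ^ 2 + (y 5 - p 5) ^ 2))}) ≤
            Λ * μH[4] ({z : EuclideanSpace ℝ (Fin 6) | ∑ i : Fin 5, z (Fin.castSucc i) ^ 2 = 1 ∧ z 5 = 0} ∩ {y : EuclideanSpace ℝ (Fin 6) | t < F (Real.sqrt (Real.arccos (∑ i : Fin 5, y (Fin.castSucc i) * (EuclideanSpace.single 0 1 : EuclideanSpace ℝ (Fin 6)) (Fin.castSucc i)) ^ 2 + (y 5 - (EuclideanSpace.single 0 1 : EuclideanSpace ℝ (Fin 6)) 5) ^ 2))})) →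
        cylDensity S p τ ≤ Λ * cylDensity {z : EuclideanSpace ℝ (Fin 6) | ∑ i : Fin 5, z (Fin.castSucc i) ^ 2 = 1 ∧ z 5 = 0} (EuclideanSpace.single 0 1 : EuclideanSpace ℝ (Fin 6)) τ := by
  intro τ Λ S F p hS hF hF0 _hp hdom hex hlev
  exact layerCake_core τ Λ S F p (EuclideanSpace.single 0 1) hS hF hF0 hdom hex hlev

end Refuter.DrefuteG2_7633.Core


/-! ## Glue: the registered 4-stub C (`stub_layerCake`) in literal form -/
namespace Refuter.DrefuteG2_7633.Lever

open Literature.Geometry.Riemannian.SphericalCylinderEntropy (zonal cylKernel cylDensity)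

/-- **Registered stub C (`stub_layerCake`), literal form**: `HarnackRadial → ZonalMonotone → ∀ Λ S, S ⊆ cylN →
SubsphericalMassIntr Λ S → ∀ p, InN p → ∀ τ, 0 < τ → cylDensity S p τ ≤ Λ * cylDensity slice₀ e₀ τ`. -/
theorem layerCake :
    (∀ τ : ℝ, 0 < τ →
        MonotoneOn (fun θ : ℝ => zonal τ (Real.cos θ) * Real.exp (θ ^ 2 / (4 * τ))) (Set.Icc 0 Real.pi)) →
    (∀ τ : ℝ, 0 < τ → MonotoneOn (zonal τ) (Set.Icc (-1) 1)) →
    ∀ (Λ : ℝ≥0∞) (S : Set (EuclideanSpace ℝ (Fin 6))),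
      S ⊆ {z : EuclideanSpace ℝ (Fin 6) | ∑ i : Fin 5, z (Fin.castSucc i) ^ 2 = 1} →
      (∀ p : EuclideanSpace ℝ (Fin 6), ∑ i : Fin 5, p (Fin.castSucc i) ^ 2 = 1 → ∀ r : ℝ, 0 < r →
          μH[4] (S ∩ {y : EuclideanSpace ℝ (Fin 6) | ∑ i : Fin 5, y (Fin.castSucc i) ^ 2 = 1 ∧ Real.arccos (∑ i : Fin 5, y (Fin.castSucc i) * p (Fin.castSucc i)) ^ 2 + (y 5 - p 5) ^ 2 ≤ r ^ 2}) ≤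
            Λ * μH[4] ({z : EuclideanSpace ℝ (Fin 6) | ∑ i : Fin 5, z (Fin.castSucc i) ^ 2 = 1 ∧ z 5 = 0} ∩
              {y : EuclideanSpace ℝ (Fin 6) | ∑ i : Fin 5, y (Fin.castSucc i) ^ 2 = 1 ∧ Real.arccos (∑ i : Fin 5, y (Fin.castSucc i) * (EuclideanSpace.single 0 1 : EuclideanSpace ℝ (Fin 6)) (Fin.castSucc i)) ^ 2 + (y 5 - (EuclideanSpace.single 0 1 : EuclideanSpace ℝ (Fin 6)) 5) ^ 2 ≤ r ^ 2})) →
      ∀ p : EuclideanSpace ℝ (Fin 6), ∑ i : Fin 5, p (Fin.castSucc i) ^ 2 = 1 → ∀ τ : ℝ, 0 < τ →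
        cylDensity S p τ ≤ Λ * cylDensity {z : EuclideanSpace ℝ (Fin 6) | ∑ i : Fin 5, z (Fin.castSucc i) ^ 2 = 1 ∧ z 5 = 0} (EuclideanSpace.single 0 1 : EuclideanSpace ℝ (Fin 6)) τ := by
  intro hA hB Λ S hS hm p hp τ hτ
  obtain ⟨F, hFa, hF0, hdom, hex⟩ := Refuter.DrefuteG2_7633.kernelDomination hA hB τ hτ
  exact Refuter.DrefuteG2_7633.Core.layerCakeCore τ Λ S F p (fun y hy => hS hy) hFa hF0 hp
    (fun y hy => hdom p y hp hy) hex
    (fun t _ => Refuter.DrefuteG2_7633.levelComparison Λ S F p t (fun y hy => hS hy) hm hFa hp)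

end Refuter.DrefuteG2_7633.Lever
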